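import Summits.CriticalPhenomena.PercolationContinuityZ3.Theorems.PercNearOneGluingNoHeavyLowerTailSunflowerRainbowReduction
import Mathlib.Algebra.CharP.Two
import HarnessLib
import HarnessLib.Audit

/-!
# `NoHeavyLowerTail` (crux stmt-CriticalPhenomena-4575), abstract sunflower cubic: READING LEMMAS for the two-stage rainbow vectors —
# the generalised key parity identity (rows whose complement is a kernel set) and the exact values of the `M`-row / `N`-column
# functionals on `rbVec`

Support file (seat `prim-l12-p2` gen 19; `--supports stmt-CriticalPhenomena-4575`).  No `sorry`, no new definitions.
Memo: run/shared/lean/prim/prim-l12/prim-l12-p2/FINDING-g19-CUBE-DUAL-CERTIFICATE.md (§1, §2).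

CONTEXT.  Gen 18 reduced ★ (`PartitionLemmaH`) to `RainbowKernelIndependence` (independence of the `rbVec ρ` over `GF(2)`); a certificate is a
family of functionals `k_ρ'` with `⟨k_ρ', rbVec ρ⟩` unitriangular, built from the `M`-rows `Y ↦ #{R' ∈ B : Y ⊆ R' ⊆ Z}` of a bottom cube `Sᶜ`
and the `N`-columns `X'' ↦ #{R ∈ A : Z ⊆ R ⊆ X''}` of a kernel cube `Xᶜ`.  This file computes the cube identities behind their values (memo §1):
* `Sunflower.crossKeyGen` — the key parity identity `Σ_O M(Y,O)·N(O,Y″)` of `…SunflowerCubeGladkovKey` WITHOUT the hypothesis `lab (W ∖ Y) ≠ 4`: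
  the value is `[Y = Y″] + [lab (W∖Y) = 4]·#{R ∈ A : W∖Y″ ⊆ R ⊆ W∖Y}`.  (Rows `Y` of the cube whose complement is a kernel set — types `(j|4)` and
  the bottom rows — are exactly the rows that READ the `(1|4)` kernel vectors `ν_P`: `⟨M(Y,·), ν_P⟩ = Φ_A(P, W∖Y)`.)
* `Sunflower.nu_read` — for `P` with `lab P = 1`, `lab (W∖P) = 4` and a row `Y` with `lab Y ∉ {1,4}`:  `Σ_O M(Y,O)·ν_P(O) = [lab (W∖Y) = 4]·Φ_A(P, W∖Y)`
  (`nu_mem_ker` of `…SunflowerRainbowKernel` is the case `lab (W∖Y) ≠ 4`).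
* `Sunflower.mu_read` — DUAL READING: for `Q` with `lab Q = 3`, `lab (W∖Q) = 0` and a column index `S ⊆ W` whose complement `Z = W∖S` has
  `lab Z ∈ {4,1,2}`:  `Σ_O μ_Q(O)·N(O,S) = Φ_B(S, Q) = #{R' ∈ B : S ⊆ R' ⊆ Q}`.
Part 2 (`…SunflowerRainbowReadingVectors`) applies these to `rbVec`: the `M`-row functional of row `Z` at a bottom spectator `S` (`lab Z ∈ {0,2,3}`)
reads `rbVec ρ` as `[TS-B coefficient of ρ at S]·Φ_A(Q1, (S ∪ Z)ᶜ)`, the `N`-column functional of column `S` at a kernel spectator `X`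
(`lab (X ∪ S)ᶜ ∈ {4,1,2}`) reads it as `[TS-A coefficient of ρ at X]·Φ_B(S, Q3)` — the two junk-free reading lemmas on which the cube-dual
certificate of the memo (§2: exact diagonal `⟨k_ρ, rbVec ρ⟩ = 1`) rests.  `RainbowKernelIndependence` itself remains OPEN.
-/

namespace Summit.CriticalPhenomena.PercolationContinuityZ3.Theorems.SunflowerPartition

open Finset

namespace Sunflower

variable {α : Type*} [DecidableEq α] (F : Sunflower α)

/-! ## The generalised key parity identity -/

/-- **GENERALISED KEY IDENTITY** (this work).  For `Y, Y″ ⊆ W` with `lab Y ≠ 4`, `lab Y″ ≠ 0`, `lab (W∖Y″) ∉ {0,4}` and `lab (W∖Y″) ≠ lab Y`: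
`Σ_{O ⊆ W} #{R' ∈ B : O ⊆ R' ⊆ Y} · #{R ∈ A : W∖Y″ ⊆ R ⊆ W∖O} ≡ [Y = Y″] + [lab (W∖Y) = 4]·#{R ∈ A : W∖Y″ ⊆ R ⊆ W∖Y} (mod 2)`.
(`crossKey` is the case `lab (W∖Y) ≠ 4`.) [this work] -/
theorem crossKeyGen (W : Finset α) {Y Y'' : Finset α} (hY : Y ⊆ W) (hY'' : Y'' ⊆ W)
    (hY4 : F.lab Y ≠ 4) (hY''0 : F.lab Y'' ≠ 0)
    (hc0 : F.lab (W \ Y'') ≠ 0) (hc4 : F.lab (W \ Y'') ≠ 4) (hne : F.lab (W \ Y'') ≠ F.lab Y) :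
    (∑ O ∈ W.powerset,
        (∑ R' ∈ W.powerset, (if F.lab R' = 0 ∧ O ⊆ R' ∧ R' ⊆ Y then (1 : ZMod 2) else 0)) *
        (∑ R ∈ W.powerset, (if F.lab R = 4 ∧ W \ Y'' ⊆ R ∧ R ⊆ W \ O then (1 : ZMod 2) else 0)))
      = (if Y = Y'' then 1 else 0)
        + (if F.lab (W \ Y) = 4 then
            ∑ R ∈ W.powerset, (if F.lab R = 4 ∧ W \ Y'' ⊆ R ∧ R ⊆ W \ Y then (1 : ZMod 2) else 0) else 0) := by
  -- (b) expand and do the `O`-sum first: `#{O ⊆ R' ∖ R} ≡ [R' ⊆ R]`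
  have hO : ∀ R' ∈ W.powerset, ∀ R ∈ W.powerset,
      (∑ O ∈ W.powerset, ((if F.lab R' = 0 ∧ O ⊆ R' ∧ R' ⊆ Y then (1 : ZMod 2) else 0) *
        (if F.lab R = 4 ∧ W \ Y'' ⊆ R ∧ R ⊆ W \ O then (1 : ZMod 2) else 0)))
        = if F.lab R' = 0 ∧ R' ⊆ Y ∧ F.lab R = 4 ∧ W \ Y'' ⊆ R ∧ R' ⊆ R then 1 else 0 := by
    intro R' hR' R hR
    have hR'W : R' ⊆ W := mem_powerset.1 hR'
    have hRW : R ⊆ W := mem_powerset.1 hR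
    by_cases h1 : F.lab R' = 0 ∧ R' ⊆ Y ∧ F.lab R = 4 ∧ W \ Y'' ⊆ R
    · rw [show (if F.lab R' = 0 ∧ R' ⊆ Y ∧ F.lab R = 4 ∧ W \ Y'' ⊆ R ∧ R' ⊆ R then (1 : ZMod 2) else 0)
          = if (∅ : Finset α) = R' \ R then 1 else 0 by
        by_cases h2 : R' ⊆ R
        · rw [if_pos ⟨h1.1, h1.2.1, h1.2.2.1, h1.2.2.2, h2⟩, if_pos (Finset.sdiff_eq_empty_iff_subset.2 h2).symm]
        · rw [if_neg fun h => h2 h.2.2.2.2, if_neg fun h => h2 (Finset.sdiff_eq_empty_iff_subset.1 h.symm)]]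
      rw [← HallGladkov.sum_powerset_ite_Icc (A := ∅) (B := R' \ R) (W := W) (sdiff_subset.trans hR'W)]
      refine sum_congr rfl fun O hO => ?_
      have hOW : O ⊆ W := mem_powerset.1 hO
      simp only [ite_zero_mul_ite_zero, one_mul]
      by_cases h3 : O ⊆ R' \ R
      · rw [if_pos (show (∅ : Finset α) ⊆ O ∧ O ⊆ R' \ R from ⟨empty_subset _, h3⟩),
          if_pos (show (F.lab R' = 0 ∧ O ⊆ R' ∧ R' ⊆ Y) ∧ F.lab R = 4 ∧ W \ Y'' ⊆ R ∧ R ⊆ W \ O from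
            ⟨⟨h1.1, h3.trans sdiff_subset, h1.2.1⟩, h1.2.2.1, h1.2.2.2,
              fun x hx => mem_sdiff.2 ⟨hRW hx, fun hxO => (mem_sdiff.1 (h3 hxO)).2 hx⟩⟩)]
      · rw [if_neg (show ¬ ((∅ : Finset α) ⊆ O ∧ O ⊆ R' \ R) from fun h => h3 h.2),
          if_neg (show ¬ ((F.lab R' = 0 ∧ O ⊆ R' ∧ R' ⊆ Y) ∧ F.lab R = 4 ∧ W \ Y'' ⊆ R ∧ R ⊆ W \ O) from
            fun h => h3 fun x hx => mem_sdiff.2 ⟨h.1.2.1 hx, fun hxR => (mem_sdiff.1 (h.2.2.2 hxR)).2 hx⟩)]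
    · rw [if_neg fun h => h1 ⟨h.1, h.2.1, h.2.2.1, h.2.2.2.1⟩]
      refine sum_eq_zero fun O _ => ?_
      rw [ite_zero_mul_ite_zero, if_neg]
      rintro ⟨⟨h0, -, hY'⟩, h4, hs, -⟩
      exact h1 ⟨h0, hY', h4, hs⟩
  rw [show (∑ O ∈ W.powerset,
        (∑ R' ∈ W.powerset, (if F.lab R' = 0 ∧ O ⊆ R' ∧ R' ⊆ Y then (1 : ZMod 2) else 0)) *
        (∑ R ∈ W.powerset, (if F.lab R = 4 ∧ W \ Y'' ⊆ R ∧ R ⊆ W \ O then (1 : ZMod 2) else 0)))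
      = ∑ R' ∈ W.powerset, ∑ R ∈ W.powerset,
          (if F.lab R' = 0 ∧ R' ⊆ Y ∧ F.lab R = 4 ∧ W \ Y'' ⊆ R ∧ R' ⊆ R then (1 : ZMod 2) else 0) by
    rw [show (∑ O ∈ W.powerset,
        (∑ R' ∈ W.powerset, (if F.lab R' = 0 ∧ O ⊆ R' ∧ R' ⊆ Y then (1 : ZMod 2) else 0)) *
        (∑ R ∈ W.powerset, (if F.lab R = 4 ∧ W \ Y'' ⊆ R ∧ R ⊆ W \ O then (1 : ZMod 2) else 0)))
      = ∑ O ∈ W.powerset, ∑ R' ∈ W.powerset, ∑ R ∈ W.powerset,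
          ((if F.lab R' = 0 ∧ O ⊆ R' ∧ R' ⊆ Y then (1 : ZMod 2) else 0) *
           (if F.lab R = 4 ∧ W \ Y'' ⊆ R ∧ R ⊆ W \ O then (1 : ZMod 2) else 0)) from
      sum_congr rfl fun O _ => Finset.sum_mul_sum _ _ _ _]
    rw [Finset.sum_comm]
    refine sum_congr rfl fun R' hR' => ?_
    rw [Finset.sum_comm]
    exact sum_congr rfl fun R hR => hO R' hR' R hR]
  -- (c) the `R`-sum: kernel supersets of `τY″ ∪ R'` ≡ label-`i″` supersets (their total is even, `τY″ ∪ R' ≠ W`)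
  have hc : ∀ R' ∈ W.powerset, F.lab R' = 0 →
      (∑ R ∈ W.powerset, (if F.lab R = 4 ∧ W \ Y'' ⊆ R ∧ R' ⊆ R then (1 : ZMod 2) else 0))
        = ∑ S ∈ W.powerset, (if F.lab S = F.lab (W \ Y'') ∧ W \ Y'' ⊆ S ∧ R' ⊆ S then (1 : ZMod 2) else 0) := by
    intro R' hR' h0
    have hR'W : R' ⊆ W := mem_powerset.1 hR'
    have htot : (∑ R ∈ W.powerset, (if (W \ Y'') ∪ R' ⊆ R then (1 : ZMod 2) else 0)) = 0 := by
      rw [HallGladkov.sum_powerset_ite_superset, if_neg]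
      intro hW
      have hsub : Y'' ⊆ R' := by
        intro x hx
        have hxW : x ∈ (W \ Y'') ∪ R' := hW.symm ▸ hY'' hx
        rcases mem_union.1 hxW with h | h
        · exact absurd hx (mem_sdiff.1 h).2
        · exact h
      exact hY''0 (F.lab_eq_zero_of_subset hsub h0)
    have hsplit : ∀ R ∈ W.powerset, (if (W \ Y'') ∪ R' ⊆ R then (1 : ZMod 2) else 0)
        = (if F.lab R = 4 ∧ W \ Y'' ⊆ R ∧ R' ⊆ R then (1 : ZMod 2) else 0)
          + (if F.lab R = F.lab (W \ Y'') ∧ W \ Y'' ⊆ R ∧ R' ⊆ R then (1 : ZMod 2) else 0) := by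
      intro R _
      by_cases h : (W \ Y'') ∪ R' ⊆ R
      · have h1 : W \ Y'' ⊆ R := subset_union_left.trans h
        have h2 : R' ⊆ R := subset_union_right.trans h
        rw [if_pos h]
        rcases F.lab_superset h1 hc0 with hl | hl
        · rw [if_neg fun h' => hc4 (hl.symm.trans h'.1), if_pos ⟨hl, h1, h2⟩, zero_add]
        · rw [if_pos ⟨hl, h1, h2⟩, if_neg fun h' => hc4 (h'.1.symm.trans hl), add_zero]
      · rw [if_neg h, if_neg fun h' => h (union_subset h'.2.1 h'.2.2), if_neg fun h' => h (union_subset h'.2.1 h'.2.2),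
          add_zero]
    rw [sum_congr rfl hsplit, sum_add_distrib] at htot
    have key := eq_neg_of_add_eq_zero_left htot
    rw [key, ZMod.neg_eq_self_mod_two]
  rw [show (∑ R' ∈ W.powerset, ∑ R ∈ W.powerset,
          (if F.lab R' = 0 ∧ R' ⊆ Y ∧ F.lab R = 4 ∧ W \ Y'' ⊆ R ∧ R' ⊆ R then (1 : ZMod 2) else 0))
      = ∑ R' ∈ W.powerset, ∑ S ∈ W.powerset,
          (if F.lab R' = 0 ∧ R' ⊆ Y ∧ F.lab S = F.lab (W \ Y'') ∧ W \ Y'' ⊆ S ∧ R' ⊆ S then (1 : ZMod 2) else 0) by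
    refine sum_congr rfl fun R' hR' => ?_
    by_cases h0 : F.lab R' = 0 ∧ R' ⊆ Y
    · have := hc R' hR' h0.1
      rw [show (∑ R ∈ W.powerset, (if F.lab R' = 0 ∧ R' ⊆ Y ∧ F.lab R = 4 ∧ W \ Y'' ⊆ R ∧ R' ⊆ R then (1 : ZMod 2) else 0))
          = ∑ R ∈ W.powerset, (if F.lab R = 4 ∧ W \ Y'' ⊆ R ∧ R' ⊆ R then (1 : ZMod 2) else 0) from
        sum_congr rfl fun R _ => by simp only [h0, true_and],
        this]
      exact sum_congr rfl fun S _ => by simp only [h0, true_and]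
    · rw [sum_congr rfl fun R _ => if_neg fun h => h0 ⟨h.1, h.2.1⟩,
        sum_congr rfl fun S _ => if_neg fun h => h0 ⟨h.1, h.2.1⟩]]
  -- (d) exchange: the `R'`-sum counts the subsets of `Y ∩ S` (all bottom, as `lab S = i″ ≠ lab Y`), odd iff `Y ∩ S = ∅`
  rw [Finset.sum_comm]
  have hd : ∀ S ∈ W.powerset,
      (∑ R' ∈ W.powerset, (if F.lab R' = 0 ∧ R' ⊆ Y ∧ F.lab S = F.lab (W \ Y'') ∧ W \ Y'' ⊆ S ∧ R' ⊆ S then (1 : ZMod 2) else 0))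
        = if F.lab S = F.lab (W \ Y'') ∧ W \ Y'' ⊆ S ∧ S ⊆ W \ Y then 1 else 0 := by
    intro S hS
    have hSW : S ⊆ W := mem_powerset.1 hS
    by_cases h1 : F.lab S = F.lab (W \ Y'') ∧ W \ Y'' ⊆ S
    · rw [show (if F.lab S = F.lab (W \ Y'') ∧ W \ Y'' ⊆ S ∧ S ⊆ W \ Y then (1 : ZMod 2) else 0)
          = if (∅ : Finset α) = Y ∩ S then 1 else 0 by
        by_cases h2 : S ⊆ W \ Y
        · rw [if_pos ⟨h1.1, h1.2, h2⟩, if_pos]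
          refine (Finset.eq_empty_iff_forall_notMem.2 fun x hx => ?_).symm
          exact (mem_sdiff.1 (h2 (mem_inter.1 hx).2)).2 (mem_inter.1 hx).1
        · rw [if_neg fun h => h2 h.2.2, if_neg]
          intro he
          exact h2 fun x hx => mem_sdiff.2 ⟨hSW hx, fun hxY => (Finset.notMem_empty x) (he.symm ▸ mem_inter.2 ⟨hxY, hx⟩)⟩]
      rw [← HallGladkov.sum_powerset_ite_Icc (A := ∅) (B := Y ∩ S) (W := W) (inter_subset_left.trans hY)]
      refine sum_congr rfl fun R' _ => ?_
      by_cases h3 : R' ⊆ Y ∩ S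
      · have hR'Y : R' ⊆ Y := h3.trans inter_subset_left
        have hR'S : R' ⊆ S := h3.trans inter_subset_right
        -- `lab R' = 0`: it is `lab Y` or `0`, and `lab S = i″` or `0`, and `i″ ≠ lab Y`
        have hl0 : F.lab R' = 0 := by
          rcases F.lab_subset hR'Y hY4 with hRY | hR0
          · rcases F.lab_subset hR'S (fun h4 => hc4 (h1.1 ▸ h4)) with hRS | hR0
            · exact absurd (hRY.symm.trans (hRS.trans h1.1)) hne.symm
            · exact hR0
          · exact hR0
        rw [if_pos ⟨hl0, hR'Y, h1.1, h1.2, hR'S⟩, if_pos ⟨empty_subset _, h3⟩]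
      · rw [if_neg fun h => h3 (subset_inter h.2.1 h.2.2.2.2), if_neg fun h => h3 h.2]
    · rw [if_neg fun h => h1 ⟨h.1, h.2.1⟩]
      exact sum_eq_zero fun R' _ => if_neg fun h => h1 ⟨h.2.2.1, h.2.2.2.1⟩
  rw [sum_congr rfl hd]
  -- (e) the interval `[τY″, τY]`: its elements have label `i″` or `4`; if `lab τY ≠ 4` all have label `i″` and the count is
  -- `[τY″ = τY] = [Y = Y″]`; if `lab τY = 4` then `Y ≠ Y″` and the count is `#interval − #(kernel sets in it)`, the interval being even.
  have hsplit2 : ∀ S ∈ W.powerset, (if W \ Y'' ⊆ S ∧ S ⊆ W \ Y then (1 : ZMod 2) else 0)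
      = (if F.lab S = F.lab (W \ Y'') ∧ W \ Y'' ⊆ S ∧ S ⊆ W \ Y then (1 : ZMod 2) else 0)
        + (if F.lab S = 4 ∧ W \ Y'' ⊆ S ∧ S ⊆ W \ Y then (1 : ZMod 2) else 0) := by
    intro S _
    by_cases h : W \ Y'' ⊆ S ∧ S ⊆ W \ Y
    · rw [if_pos h]
      rcases F.lab_superset h.1 hc0 with hl | hl
      · rw [if_pos ⟨hl, h.1, h.2⟩, if_neg fun h' => hc4 (hl.symm.trans h'.1), add_zero]
      · rw [if_neg fun h' => hc4 (h'.1.symm.trans hl), if_pos ⟨hl, h.1, h.2⟩, zero_add]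
    · rw [if_neg h, if_neg fun h' => h ⟨h'.2.1, h'.2.2⟩, if_neg fun h' => h ⟨h'.2.1, h'.2.2⟩, add_zero]
  have htot2 : (∑ S ∈ W.powerset, (if W \ Y'' ⊆ S ∧ S ⊆ W \ Y then (1 : ZMod 2) else 0))
      = if W \ Y'' = W \ Y then 1 else 0 :=
    HallGladkov.sum_powerset_ite_Icc (A := W \ Y'') (B := W \ Y) (W := W) sdiff_subset
  rw [sum_congr rfl hsplit2, sum_add_distrib] at htot2
  have hxy : (∑ S ∈ W.powerset, (if F.lab S = F.lab (W \ Y'') ∧ W \ Y'' ⊆ S ∧ S ⊆ W \ Y then (1 : ZMod 2) else 0))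
      = (if W \ Y'' = W \ Y then (1 : ZMod 2) else 0)
        + ∑ S ∈ W.powerset, (if F.lab S = 4 ∧ W \ Y'' ⊆ S ∧ S ⊆ W \ Y then (1 : ZMod 2) else 0) := by
    have := congrArg (fun t => t + ∑ S ∈ W.powerset, (if F.lab S = 4 ∧ W \ Y'' ⊆ S ∧ S ⊆ W \ Y then (1 : ZMod 2) else 0)) htot2
    simp only at this
    rw [add_assoc, CharTwo.add_self_eq_zero, add_zero] at this
    exact this
  rw [hxy]
  have hYY : (if W \ Y'' = W \ Y then (1 : ZMod 2) else 0) = if Y = Y'' then 1 else 0 := by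
    by_cases h : Y = Y''
    · rw [if_pos h, if_pos (h ▸ rfl)]
    · rw [if_neg h, if_neg]
      intro h'
      exact h (by rw [← Finset.sdiff_sdiff_eq_self hY, ← h', Finset.sdiff_sdiff_eq_self hY''])
  rw [hYY]
  by_cases h4 : F.lab (W \ Y) = 4
  · rw [if_pos h4]
  · rw [if_neg h4, add_zero]
    rw [show (∑ S ∈ W.powerset, (if F.lab S = 4 ∧ W \ Y'' ⊆ S ∧ S ⊆ W \ Y then (1 : ZMod 2) else 0)) = 0 from
      sum_eq_zero fun S _ => if_neg fun h => h4 (F.lab_eq_four_of_subset h.2.2 h.1), add_zero]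

/-! ## Reading the `(1|4)` kernel vectors with `M`-rows -/

/-- **READING LEMMA for `ν_P`** (this work): for `P ⊆ W` with `lab P = 1`, `lab (W∖P) = 4` and a row `Y ⊆ W` with `lab Y ∉ {1,4}`,
`Σ_O M(Y,O)·ν_P(O) = [lab (W∖Y) = 4]·#{R ∈ A : P ⊆ R ⊆ W∖Y}` where `ν_P(O) = #{R ∈ A : P ⊆ R ⊆ W∖O}`.
(For cross rows `Y` this is `nu_mem_ker`; the rows with kernel complement read the value `Φ_A(P, W∖Y)` exactly.) [this work] -/
theorem nu_read (W : Finset α) {Y P : Finset α} (hY : Y ⊆ W) (hP : P ⊆ W) (hY4 : F.lab Y ≠ 4) (hY1 : F.lab Y ≠ 1)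
    (hP1 : F.lab P = 1) (hcP : F.lab (W \ P) = 4) :
    (∑ O ∈ W.powerset,
        (∑ R' ∈ W.powerset, (if F.lab R' = 0 ∧ O ⊆ R' ∧ R' ⊆ Y then (1 : ZMod 2) else 0)) *
        (∑ R ∈ W.powerset, (if F.lab R = 4 ∧ P ⊆ R ∧ R ⊆ W \ O then (1 : ZMod 2) else 0)))
      = if F.lab (W \ Y) = 4 then ∑ R ∈ W.powerset, (if F.lab R = 4 ∧ P ⊆ R ∧ R ⊆ W \ Y then (1 : ZMod 2) else 0) else 0 := by
  have hWP : W \ (W \ P) = P := Finset.sdiff_sdiff_eq_self hP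
  have key := F.crossKeyGen W (Y := Y) (Y'' := W \ P) hY sdiff_subset hY4 (by rw [hcP]; decide)
    (by rw [hWP, hP1]; decide) (by rw [hWP, hP1]; decide) (by rw [hWP, hP1]; exact fun h => hY1 h.symm)
  rw [hWP] at key
  rw [key, if_neg, zero_add]
  rintro rfl
  exact hY4 hcP

/-! ## Dual reading: `N`-columns against the `(3|0)` kernel vectors `μ_Q` -/

/-- **DUAL READING LEMMA for `μ_Q`** (this work): for `Q ⊆ W` with `lab Q = 3`, `lab (W∖Q) = 0` and a column index `S ⊆ W` whose complement
`W∖S` has label `4`, `1` or `2`:  `Σ_O μ_Q(O)·N(O,S) = #{R' ∈ B : S ⊆ R' ⊆ Q}`, where `μ_Q(O) = #{R' ∈ B : O ⊆ R' ⊆ Q}` and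
`N(O,S) = #{R ∈ A : W∖S ⊆ R ⊆ W∖O}`. [this work] -/
theorem mu_read (W : Finset α) {Q S : Finset α} (hQ : Q ⊆ W) (hS : S ⊆ W) (hQ3 : F.lab Q = 3) (hcQ : F.lab (W \ Q) = 0)
    (hZ : F.lab (W \ S) = 4 ∨ F.lab (W \ S) = 1 ∨ F.lab (W \ S) = 2) :
    (∑ O ∈ W.powerset,
        (∑ R' ∈ W.powerset, (if F.lab R' = 0 ∧ O ⊆ R' ∧ R' ⊆ Q then (1 : ZMod 2) else 0)) *
        (∑ R ∈ W.powerset, (if F.lab R = 4 ∧ W \ S ⊆ R ∧ R ⊆ W \ O then (1 : ZMod 2) else 0)))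
      = ∑ R' ∈ W.powerset, (if F.lab R' = 0 ∧ S ⊆ R' ∧ R' ⊆ Q then (1 : ZMod 2) else 0) := by
  have _ := hQ
  -- (1) expand and do the `O`-sum: `#{O ⊆ R' ∖ R} ≡ [R' ⊆ R]`
  have hO : ∀ R' ∈ W.powerset, ∀ R ∈ W.powerset,
      (∑ O ∈ W.powerset, ((if F.lab R' = 0 ∧ O ⊆ R' ∧ R' ⊆ Q then (1 : ZMod 2) else 0) *
        (if F.lab R = 4 ∧ W \ S ⊆ R ∧ R ⊆ W \ O then (1 : ZMod 2) else 0)))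
        = if F.lab R' = 0 ∧ R' ⊆ Q ∧ F.lab R = 4 ∧ W \ S ⊆ R ∧ R' ⊆ R then 1 else 0 := by
    intro R' hR' R hR
    have hR'W : R' ⊆ W := mem_powerset.1 hR'
    have hRW : R ⊆ W := mem_powerset.1 hR
    by_cases h1 : F.lab R' = 0 ∧ R' ⊆ Q ∧ F.lab R = 4 ∧ W \ S ⊆ R
    · rw [show (if F.lab R' = 0 ∧ R' ⊆ Q ∧ F.lab R = 4 ∧ W \ S ⊆ R ∧ R' ⊆ R then (1 : ZMod 2) else 0)
          = if (∅ : Finset α) = R' \ R then 1 else 0 by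
        by_cases h2 : R' ⊆ R
        · rw [if_pos ⟨h1.1, h1.2.1, h1.2.2.1, h1.2.2.2, h2⟩, if_pos (Finset.sdiff_eq_empty_iff_subset.2 h2).symm]
        · rw [if_neg fun h => h2 h.2.2.2.2, if_neg fun h => h2 (Finset.sdiff_eq_empty_iff_subset.1 h.symm)]]
      rw [← HallGladkov.sum_powerset_ite_Icc (A := ∅) (B := R' \ R) (W := W) (sdiff_subset.trans hR'W)]
      refine sum_congr rfl fun O hO => ?_
      simp only [ite_zero_mul_ite_zero, one_mul]
      by_cases h3 : O ⊆ R' \ R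
      · rw [if_pos (show (∅ : Finset α) ⊆ O ∧ O ⊆ R' \ R from ⟨empty_subset _, h3⟩),
          if_pos (show (F.lab R' = 0 ∧ O ⊆ R' ∧ R' ⊆ Q) ∧ F.lab R = 4 ∧ W \ S ⊆ R ∧ R ⊆ W \ O from
            ⟨⟨h1.1, h3.trans sdiff_subset, h1.2.1⟩, h1.2.2.1, h1.2.2.2,
              fun x hx => mem_sdiff.2 ⟨hRW hx, fun hxO => (mem_sdiff.1 (h3 hxO)).2 hx⟩⟩)]
      · rw [if_neg (show ¬ ((∅ : Finset α) ⊆ O ∧ O ⊆ R' \ R) from fun h => h3 h.2),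
          if_neg (show ¬ ((F.lab R' = 0 ∧ O ⊆ R' ∧ R' ⊆ Q) ∧ F.lab R = 4 ∧ W \ S ⊆ R ∧ R ⊆ W \ O) from
            fun h => h3 fun x hx => mem_sdiff.2 ⟨h.1.2.1 hx, fun hxR => (mem_sdiff.1 (h.2.2.2 hxR)).2 hx⟩)]
    · rw [if_neg fun h => h1 ⟨h.1, h.2.1, h.2.2.1, h.2.2.2.1⟩]
      refine sum_eq_zero fun O _ => ?_
      rw [ite_zero_mul_ite_zero, if_neg]
      rintro ⟨⟨h0, -, hQ'⟩, h4, hs, -⟩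
      exact h1 ⟨h0, hQ', h4, hs⟩
  rw [show (∑ O ∈ W.powerset,
        (∑ R' ∈ W.powerset, (if F.lab R' = 0 ∧ O ⊆ R' ∧ R' ⊆ Q then (1 : ZMod 2) else 0)) *
        (∑ R ∈ W.powerset, (if F.lab R = 4 ∧ W \ S ⊆ R ∧ R ⊆ W \ O then (1 : ZMod 2) else 0)))
      = ∑ R' ∈ W.powerset, ∑ R ∈ W.powerset,
          (if F.lab R' = 0 ∧ R' ⊆ Q ∧ F.lab R = 4 ∧ W \ S ⊆ R ∧ R' ⊆ R then (1 : ZMod 2) else 0) by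
    rw [show (∑ O ∈ W.powerset,
        (∑ R' ∈ W.powerset, (if F.lab R' = 0 ∧ O ⊆ R' ∧ R' ⊆ Q then (1 : ZMod 2) else 0)) *
        (∑ R ∈ W.powerset, (if F.lab R = 4 ∧ W \ S ⊆ R ∧ R ⊆ W \ O then (1 : ZMod 2) else 0)))
      = ∑ O ∈ W.powerset, ∑ R' ∈ W.powerset, ∑ R ∈ W.powerset,
          ((if F.lab R' = 0 ∧ O ⊆ R' ∧ R' ⊆ Q then (1 : ZMod 2) else 0) *
           (if F.lab R = 4 ∧ W \ S ⊆ R ∧ R ⊆ W \ O then (1 : ZMod 2) else 0)) from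
      sum_congr rfl fun O _ => Finset.sum_mul_sum _ _ _ _]
    rw [Finset.sum_comm]
    refine sum_congr rfl fun R' hR' => ?_
    rw [Finset.sum_comm]
    exact sum_congr rfl fun R hR => hO R' hR' R hR]
  -- (2) the `R`-sum for fixed bottom `R' ⊆ Q`: supersets of `(W∖S) ∪ R'` have label `lab (W∖S)` or `4`; the kernel ones number
  --     `[ (W∖S) ∪ R' = W ] + [lab (W∖S) ≠ 4]·#{T : lab T = lab (W∖S), (W∖S) ∪ R' ⊆ T}`
  have hc0 : F.lab (W \ S) ≠ 0 := by rcases hZ with h | h | h <;> rw [h] <;> decide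
  have hsplit : ∀ R' ∈ W.powerset, ∀ R ∈ W.powerset, (if (W \ S) ∪ R' ⊆ R then (1 : ZMod 2) else 0)
      = (if F.lab R = 4 ∧ W \ S ⊆ R ∧ R' ⊆ R then (1 : ZMod 2) else 0)
        + (if F.lab R ≠ 4 ∧ F.lab R = F.lab (W \ S) ∧ W \ S ⊆ R ∧ R' ⊆ R then (1 : ZMod 2) else 0) := by
    intro R' _ R _
    by_cases h : (W \ S) ∪ R' ⊆ R
    · have h1 : W \ S ⊆ R := subset_union_left.trans h
      have h2 : R' ⊆ R := subset_union_right.trans h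
      rw [if_pos h]
      by_cases h4 : F.lab R = 4
      · rw [if_pos ⟨h4, h1, h2⟩, if_neg fun h' => h'.1 h4, add_zero]
      · rcases F.lab_superset h1 hc0 with hl | hl
        · rw [if_neg fun h' => h4 h'.1, if_pos ⟨h4, hl, h1, h2⟩, zero_add]
        · exact absurd hl h4
    · rw [if_neg h, if_neg fun h' => h (union_subset h'.2.1 h'.2.2), if_neg fun h' => h (union_subset h'.2.2.1 h'.2.2.2),
        add_zero]
  have hc : ∀ R' ∈ W.powerset,
      (∑ R ∈ W.powerset, (if F.lab R = 4 ∧ W \ S ⊆ R ∧ R' ⊆ R then (1 : ZMod 2) else 0))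
        = (if (W \ S) ∪ R' = W then 1 else 0)
          + ∑ R ∈ W.powerset, (if F.lab R ≠ 4 ∧ F.lab R = F.lab (W \ S) ∧ W \ S ⊆ R ∧ R' ⊆ R then (1 : ZMod 2) else 0) := by
    intro R' hR'
    have htot : (∑ R ∈ W.powerset, (if (W \ S) ∪ R' ⊆ R then (1 : ZMod 2) else 0)) = if (W \ S) ∪ R' = W then 1 else 0 :=
      HallGladkov.sum_powerset_ite_superset _ _
    rw [sum_congr rfl (hsplit R' hR'), sum_add_distrib] at htot
    have := congrArg (fun t => t + ∑ R ∈ W.powerset,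
      (if F.lab R ≠ 4 ∧ F.lab R = F.lab (W \ S) ∧ W \ S ⊆ R ∧ R' ⊆ R then (1 : ZMod 2) else 0)) htot
    simp only at this
    rw [add_assoc, CharTwo.add_self_eq_zero, add_zero] at this
    exact this
  rw [show (∑ R' ∈ W.powerset, ∑ R ∈ W.powerset,
          (if F.lab R' = 0 ∧ R' ⊆ Q ∧ F.lab R = 4 ∧ W \ S ⊆ R ∧ R' ⊆ R then (1 : ZMod 2) else 0))
      = (∑ R' ∈ W.powerset, (if F.lab R' = 0 ∧ R' ⊆ Q ∧ (W \ S) ∪ R' = W then (1 : ZMod 2) else 0))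
        + ∑ R' ∈ W.powerset, ∑ R ∈ W.powerset,
          (if F.lab R' = 0 ∧ R' ⊆ Q ∧ F.lab R ≠ 4 ∧ F.lab R = F.lab (W \ S) ∧ W \ S ⊆ R ∧ R' ⊆ R then (1 : ZMod 2) else 0) by
    rw [← sum_add_distrib]
    refine sum_congr rfl fun R' hR' => ?_
    by_cases h0 : F.lab R' = 0 ∧ R' ⊆ Q
    · rw [show (∑ R ∈ W.powerset, (if F.lab R' = 0 ∧ R' ⊆ Q ∧ F.lab R = 4 ∧ W \ S ⊆ R ∧ R' ⊆ R then (1 : ZMod 2) else 0))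
          = ∑ R ∈ W.powerset, (if F.lab R = 4 ∧ W \ S ⊆ R ∧ R' ⊆ R then (1 : ZMod 2) else 0) from
        sum_congr rfl fun R _ => by simp only [h0, true_and], hc R' hR']
      simp only [h0, true_and]
    · rw [sum_congr rfl fun R _ => if_neg fun h => h0 ⟨h.1, h.2.1⟩, sum_const_zero, if_neg fun h => h0 ⟨h.1, h.2.1⟩,
        sum_congr rfl fun R _ => if_neg fun h => h0 ⟨h.1, h.2.1⟩, sum_const_zero, add_zero]]
  -- (3) the double sum over (`R'` bottom ⊆ Q, `T = R` of petal label `lab (W∖S)` above `(W∖S) ∪ R'`) vanishes: exchanging, for fixed `T`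
  --     the `R'` run over all subsets of `Q ∩ T` (a bottom set), an even number unless `Q ∩ T = ∅`, which would put `T` below `W∖Q ∈ B`.
  have hvan : (∑ R' ∈ W.powerset, ∑ R ∈ W.powerset,
      (if F.lab R' = 0 ∧ R' ⊆ Q ∧ F.lab R ≠ 4 ∧ F.lab R = F.lab (W \ S) ∧ W \ S ⊆ R ∧ R' ⊆ R then (1 : ZMod 2) else 0)) = 0 := by
    rw [Finset.sum_comm]
    refine sum_eq_zero fun T hT => ?_
    have hTW : T ⊆ W := mem_powerset.1 hT
    by_cases h1 : F.lab T ≠ 4 ∧ F.lab T = F.lab (W \ S) ∧ W \ S ⊆ T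
    · -- every subset of `Q ∩ T` is a bottom set
      have hQT0 : F.lab (Q ∩ T) = 0 := by
        rcases F.lab_subset (inter_subset_left : Q ∩ T ⊆ Q) (by rw [hQ3]; decide) with h | h
        · rcases F.lab_subset (inter_subset_right : Q ∩ T ⊆ T) h1.1 with h' | h'
          · exfalso
            have h3 : F.lab (W \ S) = 3 := h1.2.1 ▸ h' ▸ h ▸ hQ3 |>.symm ▸ rfl
            rcases hZ with hz | hz | hz <;> rw [hz] at h3 <;> exact absurd h3 (by decide)
          · exact h'
        · exact h
      rw [show (∑ R' ∈ W.powerset, (if F.lab R' = 0 ∧ R' ⊆ Q ∧ F.lab T ≠ 4 ∧ F.lab T = F.lab (W \ S) ∧ W \ S ⊆ T ∧ R' ⊆ T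
            then (1 : ZMod 2) else 0))
          = ∑ R' ∈ W.powerset, (if (∅ : Finset α) ⊆ R' ∧ R' ⊆ Q ∩ T then (1 : ZMod 2) else 0) by
        refine sum_congr rfl fun R' _ => ?_
        by_cases h2 : R' ⊆ Q ∩ T
        · rw [if_pos ⟨F.lab_eq_zero_of_subset h2 hQT0, h2.trans inter_subset_left, h1.1, h1.2.1, h1.2.2, h2.trans inter_subset_right⟩,
            if_pos ⟨empty_subset _, h2⟩]
        · rw [if_neg fun h => h2 (subset_inter h.2.1 h.2.2.2.2.2), if_neg fun h => h2 h.2]]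
      rw [HallGladkov.sum_powerset_ite_Icc (A := ∅) (B := Q ∩ T) (W := W) (inter_subset_right.trans hTW), if_neg]
      intro he
      -- `Q ∩ T = ∅` ⇒ `T ⊆ W ∖ Q` ⇒ `lab T = 0`, contradicting `lab T = lab (W∖S) ≠ 0`
      have hTQ : T ⊆ W \ Q := fun x hx => mem_sdiff.2 ⟨hTW hx, fun hxQ => (Finset.notMem_empty x) (he ▸ mem_inter.2 ⟨hxQ, hx⟩)⟩
      exact hc0 (h1.2.1 ▸ F.lab_eq_zero_of_subset hTQ hcQ)
    · exact sum_eq_zero fun R' _ => if_neg fun h => h1 ⟨h.2.2.1, h.2.2.2.1, h.2.2.2.2.1⟩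
  rw [hvan, add_zero]
  -- (4) `(W∖S) ∪ R' = W ⟺ S ⊆ R'` for `R' ⊆ W`
  refine sum_congr rfl fun R' hR' => ?_
  have hR'W : R' ⊆ W := mem_powerset.1 hR'
  by_cases h0 : F.lab R' = 0 ∧ R' ⊆ Q
  · have hiff : (W \ S) ∪ R' = W ↔ S ⊆ R' := by
      constructor
      · intro hW x hx
        have hxW : x ∈ (W \ S) ∪ R' := hW.symm ▸ hS hx
        rcases mem_union.1 hxW with h | h
        · exact absurd hx (mem_sdiff.1 h).2
        · exact h
      · intro hSR
        refine Subset.antisymm (union_subset sdiff_subset hR'W) fun x hx => ?_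
        by_cases hxS : x ∈ S
        · exact mem_union_right _ (hSR hxS)
        · exact mem_union_left _ (mem_sdiff.2 ⟨hx, hxS⟩)
    by_cases hSR : S ⊆ R'
    · rw [if_pos ⟨h0.1, h0.2, hiff.2 hSR⟩, if_pos ⟨h0.1, hSR, h0.2⟩]
    · rw [if_neg fun h => hSR (hiff.1 h.2.2), if_neg fun h => hSR h.2.1]
  · rw [if_neg fun h => h0 ⟨h.1, h.2.1⟩, if_neg fun h => h0 ⟨h.1, h.2.2⟩]


end Sunflower

end Summit.CriticalPhenomena.PercolationContinuityZ3.Theorems.SunflowerPartition
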